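import Literature.IUT.HodgeTheaters.ConventionsCatIsomorphismKinds
import Literature.IUT.HodgeTheaters.GoodLocalFrobenioidOfGaloisCatIsomorphism
import Literature.IUT.HodgeTheaters.InitialThetaDataGoodLocalFrobenioid
import HarnessLib

/-!
# [IUTchI] Cor 5.3 (ii) AT THE GENUINE GOOD NON-ARCHIMEDEAN PLACE: «`Aut(𝒞_v) → Aut(𝒟_v)` bijective» modulo print's two halves
# (proof-only; T5 «COR53II-AT-GENUINE-PLACE», L5-lead RULINGS #113 (2) / #116 (1)(c))

S. Mochizuki, *Inter-universal Teichmüller theory I*, kurims manuscript (May 2020), §5 Corollary 5.3 (ii) p. 144 l. 14–18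
(«For `i = 1, 2`, let `ⁱ𝔉` be an `ℱ`-prime-strip; `ⁱ𝔇` the `𝒟`-prime-strip associated to `ⁱ𝔉`. Then the natural map
`Isom(¹𝔉, ²𝔉) → Isom(¹𝔇, ²𝔇)` is bijective»), proof p. 144 l. 36–39 («follows immediately from [AbsTopIII], Proposition 3.2,
(iv); [AbsTopIII], Proposition 4.2, (i)»), and the shape of the argument printed for (iv), p. 144 l. 41–45 («surjectivity follows
immediately from the construction … it remains to verify injectivity … let `α ∈ Ker` … [wlog] `α` lies over the identity … `α` is
[isomorphic to] the identity»); Example 3.3 (i) p. 77 («`𝒟_v := ℬ(X̲→_v)⁰`», «`𝒞_v` … `p_v`-adic Frobenioid»)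
([IUTchI] Cor 5.3 (ii) p.144) [claim: Mochizuki2012, status: disputed] (D-0012 claim key; nothing of the series is asserted;
no side taken on [IUTchIII] Cor. 3.12).

PROOF-ONLY ASSEMBLY (theorems only; typer of record abc-iut-L5-t4).  By abc-iut-L5-t4's `FKit.isomFtoDBijective_iff_model`
(p409092) and `CatIsomorphism.mapIso_kindFunctor_bijective_iff` (p492186) the token `IUTchI:Cor5.3(ii)` is, place by place,
the MODEL CASE «the natural map `Aut(𝒞_v) → Aut(𝒟_v)` of §0 is bijective» = `CatIsomorphism.DescendBijective`.  This file
proves it at the REAL good non-archimedean carriers of the tree from print's two halves, each a DISPLAYED input: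
* INJECTIVITY input `hker` — «every self-equivalence of `𝒞_v` lying over the identity of `𝒟_v` is isomorphic to the
  identity» (print p. 144 l. 43–45; [AbsTopIII] Prop 3.2 (iv) injectivity at the place; in the tree it is the conclusion of
  abc-iut-L1-t7's [FrdI] rigidity S2/S2′ — `ModelFrobenioid.selfEquivalence_iso_id_of_over_base` p491743 and the unit-RATIO
  form S2′ ruled in L5-lead RULINGS #116 (1)(a) — fed by the Kummer pair rigidity N1 p489714 / N3 p490952 / N3c p493397 /
  N3b p494180 (row S2c); NOT the gauge-fixed `hmon` shape, which L1-t7's finding F1 shows vacuous as a law);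
* SURJECTIVITY input `hlift` — «every self-equivalence of `𝒟_v` lifts» (print p. 144 l. 41–43; [AbsTopIII] Prop 3.2 (iv)
  bijectivity for pairs of hyperbolic orbicurve type, FACT schema F-0409 `GaloisIsoLiftsToTMPairIso`, instance p432154,
  composed with the construction's functoriality — BY NAME);
via abc-iut-L5-t4's `CatIsomorphism.descend_injective_of_kernel_trivial` (p492186) and `descend_surjective_of_lifts`
(p491065), the §0 binders `he`/`hu` being DISCHARGED by abc-iut-w4-d109's T3 (`GoodLocalFrobenioidOfGaloisCatIsomorphism`
p493980: `hasUnder_base_cosetCat`, `underUnique_base_cosetCat`, `hasUnder_toBase_ofGalois`, `underUnique_toBase_ofGalois`,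
[FrdI] Cor 4.11 (ii) at `Cor411Padic`):
* §1 at ANY [FrdII] Ex 1.1 `p`-adic Frobenioid over a slim REAL coset base `ℬ(Π)⁰ = CosetCat Π`;
* §2 at the REAL `GoodLocalFrobenioid.ofGalois d aug …` (abc-iut-L5-t2/t16);
* §3 at the GENUINE place of the initial Θ-data `D.goodLocalFrobenioidOfEmb p k ι hX` ([IUTchI] Ex 3.3 (i)–(ii) for `D` at
  `v̲ ∈ V̲^good ∩ V̲^non`, `Π_v̲ := Π_{X̲→_v̲}` of Def 3.1 (f); abc-iut-L5-t2 `InitialThetaDataGoodLocalFrobenioid`), every `ι`.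
Binder census of §3: by-name {`IsSlim (CosetCat Π_v̲)`} · inputs {hker (rigidity rows' conclusion), hlift (FACT)} · DATA
{D, p, k, ι, hX}.  Typed ≠ proved for hker/hlift; no token flip is claimed by this file alone.
-/

namespace Literature.IUT.HodgeTheaters

open CategoryTheory Opposite Literature.AlgebraicGeometry.Frobenioids Literature.AnabelianGeometry.SemiGraphs
open Literature.AlgebraicGeometry.Frobenioids.PadicFrd

universe u

namespace Cor53

/-! ### §1. At a `p`-adic Frobenioid over a slim REAL coset base `ℬ(Π)⁰ = CosetCat Π` -/

section CosetBase

variable {P : Type u} [Group P] [TopologicalSpace P] [IsTopologicalGroup P] {p : ℕ} [Fact p.Prime]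
  (Q : Datum (CosetCat P) p)

/-- **Cor 5.3 (ii) model case, INJECTIVITY, at a `p`-adic Frobenioid over a slim coset base `ℬ(Π)⁰`** — the §0 natural map
`Aut(𝒞_v) → Aut(ℬ(Π)⁰)` (binders `he`/`hu` discharged by abc-iut-w4-d109) is injective as soon as every self-equivalence of
`𝒞_v` lying over the identity of the base is isomorphic to the identity (print p. 144 l. 43–45).
([IUTchI] Cor 5.3 (ii) p.144) [claim: Mochizuki2012, status: disputed] -/
theorem cosetCat_descend_injective_of_kernel_trivial (hsl : IsSlim (CosetCat P))
    (hker : ∀ Ψ : Q.frobenioid ≌ Q.frobenioid,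
      Nonempty (CatIsomorphism.LiesUnder (ModelFrobenioid.baseFunctor Q.Φ Q.B Q.divB) (ModelFrobenioid.baseFunctor Q.Φ Q.B Q.divB)
        Ψ (CategoryTheory.Equivalence.refl (C := CosetCat P))) →
      Nonempty (Ψ.functor ≅ 𝟭 Q.frobenioid)) :
    Function.Injective (CatIsomorphism.descend (GoodLocalFrobenioid.hasUnder_base_cosetCat Q Q hsl hsl)
      (GoodLocalFrobenioid.underUnique_base_cosetCat Q Q hsl hsl)) :=
  CatIsomorphism.descend_injective_of_kernel_trivial _ _ hker

/-- **Cor 5.3 (ii) model case AS PRINTED («bijective») at a `p`-adic Frobenioid over a slim coset base**, from print's two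
halves: kernel triviality (injectivity) and lifting (surjectivity). ([IUTchI] Cor 5.3 (ii) p.144) [claim: Mochizuki2012, status: disputed] -/
theorem cosetCat_descendBijective_of_kernel_trivial_of_lifts (hsl : IsSlim (CosetCat P))
    (hker : ∀ Ψ : Q.frobenioid ≌ Q.frobenioid,
      Nonempty (CatIsomorphism.LiesUnder (ModelFrobenioid.baseFunctor Q.Φ Q.B Q.divB) (ModelFrobenioid.baseFunctor Q.Φ Q.B Q.divB)
        Ψ (CategoryTheory.Equivalence.refl (C := CosetCat P))) →
      Nonempty (Ψ.functor ≅ 𝟭 Q.frobenioid))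
    (hlift : ∀ Θ : CosetCat P ≌ CosetCat P, ∃ Ψ : Q.frobenioid ≌ Q.frobenioid,
      Nonempty (CatIsomorphism.LiesUnder (ModelFrobenioid.baseFunctor Q.Φ Q.B Q.divB)
        (ModelFrobenioid.baseFunctor Q.Φ Q.B Q.divB) Ψ Θ)) :
    CatIsomorphism.DescendBijective (ModelFrobenioid.baseFunctor Q.Φ Q.B Q.divB) (ModelFrobenioid.baseFunctor Q.Φ Q.B Q.divB)
      (GoodLocalFrobenioid.hasUnder_base_cosetCat Q Q hsl hsl) (GoodLocalFrobenioid.underUnique_base_cosetCat Q Q hsl hsl) :=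
  ⟨cosetCat_descend_injective_of_kernel_trivial Q hsl hker, CatIsomorphism.descend_surjective_of_lifts _ _ hlift⟩

end CosetBase

/-! ### §2. At the REAL `GoodLocalFrobenioid.ofGalois` ([IUTchI] Ex 3.3 (i) over REAL coset bases) -/

section OfGalois

variable {p : ℕ} [Fact p.Prime] (d : GaloisValDatum.{u} p) {P : Type u} [Group P] [TopologicalSpace P]
  [IsTopologicalGroup P] (aug : P →* d.Gal) (hc : Continuous aug) (hs : Function.Surjective aug) (ho : IsOpenMap aug)
  (Kv : Type) [Field Kv] [ValuativeRel Kv] (hp : ((p : Kv)) ∈ PadicFrd.intNonzero Kv)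

/-- **Cor 5.3 (ii) model case AS PRINTED at the REAL `C_v = (ofGalois d aug …).Cv` over `𝒟_v = ℬ(Π_v)⁰`**: the natural map
`Aut(C_v) → Aut(𝒟_v)` (`CatIsomorphism.descend` with abc-iut-w4-d109's binder-discharging `hasUnder_toBase_ofGalois` /
`underUnique_toBase_ofGalois`) is BIJECTIVE modulo {IsSlim (CosetCat Π_v)} + kernel triviality hker + lifting hlift.
([IUTchI] Cor 5.3 (ii) p.144) [claim: Mochizuki2012, status: disputed] -/
theorem ofGalois_descendBijective_of_kernel_trivial_of_lifts (hsl : IsSlim (CosetCat P))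
    (hker : ∀ Ψ : (GoodLocalFrobenioid.ofGalois d aug hc hs ho Kv hp).Cv ≌ (GoodLocalFrobenioid.ofGalois d aug hc hs ho Kv hp).Cv,
      Nonempty (CatIsomorphism.LiesUnder (GoodLocalFrobenioid.ofGalois d aug hc hs ho Kv hp).toBase
        (GoodLocalFrobenioid.ofGalois d aug hc hs ho Kv hp).toBase Ψ (CategoryTheory.Equivalence.refl (C := CosetCat P))) →
      Nonempty (Ψ.functor ≅ 𝟭 (GoodLocalFrobenioid.ofGalois d aug hc hs ho Kv hp).Cv))
    (hlift : ∀ Θ : CosetCat P ≌ CosetCat P,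
      ∃ Ψ : (GoodLocalFrobenioid.ofGalois d aug hc hs ho Kv hp).Cv ≌ (GoodLocalFrobenioid.ofGalois d aug hc hs ho Kv hp).Cv,
        Nonempty (CatIsomorphism.LiesUnder (GoodLocalFrobenioid.ofGalois d aug hc hs ho Kv hp).toBase
          (GoodLocalFrobenioid.ofGalois d aug hc hs ho Kv hp).toBase Ψ Θ)) :
    CatIsomorphism.DescendBijective (GoodLocalFrobenioid.ofGalois d aug hc hs ho Kv hp).toBase
      (GoodLocalFrobenioid.ofGalois d aug hc hs ho Kv hp).toBase
      (GoodLocalFrobenioid.hasUnder_toBase_ofGalois d aug hc hs ho Kv hp d aug hc hs ho Kv hp hsl hsl)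
      (GoodLocalFrobenioid.underUnique_toBase_ofGalois d aug hc hs ho Kv hp d aug hc hs ho Kv hp hsl hsl) :=
  ⟨CatIsomorphism.descend_injective_of_kernel_trivial _ _ hker, CatIsomorphism.descend_surjective_of_lifts _ _ hlift⟩

end OfGalois

/-! ### §3. At the GENUINE good place of the initial Θ-data: `D.goodLocalFrobenioidOfEmb p k ι hX` (Ex 3.3 (i)–(ii) for `D`) -/

section GenuinePlace

universe uF vK

variable {F : Type uF} {K : Type vK} {Fbar : Type} [Field F] [NumberField F] [Field K] [NumberField K]
  [Algebra F K] [Field Fbar] [Algebra F Fbar] [Algebra K Fbar] [IsScalarTower F K Fbar] [Normal K Fbar]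
  {E : WeierstrassCurve F} [E.IsElliptic] {l : ℕ} {Pb : BadPlacePredicates K}
  (D : InitialThetaData F K Fbar E l Pb) (p : ℕ) [Fact p.Prime]
  (k : Type) [NontriviallyNormedField k] [CompleteSpace k] [IsUltrametricDist k] [NormedAlgebra ℚ_[p] k]
  [FiniteDimensional ℚ_[p] k] [Algebra K k] (ι : Fbar →ₐ[K] AlgebraicClosure k) (hX : IsOpen (D.PiXarrow : Set D.PiC))

/-- **[IUTchI] Cor 5.3 (ii), model case AS PRINTED, AT THE GENUINE PLACE `v̲ ∈ V̲^good ∩ V̲^non` of the initial Θ-data**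
(`𝒞_v̲ := (D.goodLocalFrobenioidOfEmb p k ι hX).Cv`, the [FrdII] Ex 1.1 `p_v̲`-adic Frobenioid over `𝒟_v̲ = ℬ(Π_v̲)⁰ = CosetCat Π_v̲`,
`Π_v̲ := Π_{X̲→_v̲}` of [IUTchI] Def 3.1 (f), for EVERY `K`-embedding `ι : F̄ → k̄`; valuative structure of `k` = the norm's,
`GaloisValDatum.normVal k`, as in abc-iut-L5-t2's definition): «the natural map `Aut(𝒞_v̲) → Aut(𝒟_v̲)` is bijective» —
`CatIsomorphism.DescendBijective` with the §0 natural map's binders DISCHARGED (abc-iut-w4-d109 T3) — from print's two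
halves, DISPLAYED: `hker` (injectivity content, [AbsTopIII] Prop 3.2 (iv) at the place — the conclusion of the rigidity rows
S2/S2′ ∘ S2c) and `hlift` (surjectivity, F-0409 / p432154 through the construction), plus the by-name slimness of
`ℬ(Π_v̲)⁰` ([AbsAnab] §1).  Binder census: by-name 1 · inputs 2. ([IUTchI] Cor 5.3 (ii) p.144) [claim: Mochizuki2012, status: disputed] -/
theorem goodLocalFrobenioidOfEmb_descendBijective_of_kernel_trivial_of_lifts
    (hsl : IsSlim (CosetCat (D.PiLoc D.PiXarrow (localToGF F k ι))))
    (hker : letI := GaloisValDatum.normVal k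
      ∀ Ψ : (D.goodLocalFrobenioidOfEmb p k ι hX).Cv ≌ (D.goodLocalFrobenioidOfEmb p k ι hX).Cv,
      Nonempty (CatIsomorphism.LiesUnder (D.goodLocalFrobenioidOfEmb p k ι hX).toBase
        (D.goodLocalFrobenioidOfEmb p k ι hX).toBase Ψ
        (CategoryTheory.Equivalence.refl (C := CosetCat (D.PiLoc D.PiXarrow (localToGF F k ι))))) →
      Nonempty (Ψ.functor ≅ 𝟭 (D.goodLocalFrobenioidOfEmb p k ι hX).Cv))
    (hlift : letI := GaloisValDatum.normVal k
      ∀ Θ : CosetCat (D.PiLoc D.PiXarrow (localToGF F k ι)) ≌ CosetCat (D.PiLoc D.PiXarrow (localToGF F k ι)),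
      ∃ Ψ : (D.goodLocalFrobenioidOfEmb p k ι hX).Cv ≌ (D.goodLocalFrobenioidOfEmb p k ι hX).Cv,
        Nonempty (CatIsomorphism.LiesUnder (D.goodLocalFrobenioidOfEmb p k ι hX).toBase
          (D.goodLocalFrobenioidOfEmb p k ι hX).toBase Ψ Θ)) :
    letI := GaloisValDatum.normVal k
    CatIsomorphism.DescendBijective (D.goodLocalFrobenioidOfEmb p k ι hX).toBase (D.goodLocalFrobenioidOfEmb p k ι hX).toBase
      (GoodLocalFrobenioid.hasUnder_toBase_ofGalois _ _ _ _ _ _ _ _ _ _ _ _ _ _ hsl hsl)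
      (GoodLocalFrobenioid.underUnique_toBase_ofGalois _ _ _ _ _ _ _ _ _ _ _ _ _ _ hsl hsl) := by
  letI := GaloisValDatum.normVal k
  unfold InitialThetaData.goodLocalFrobenioidOfEmb at hker hlift ⊢
  exact ofGalois_descendBijective_of_kernel_trivial_of_lifts _ _ _ _ _ _ _ hsl hker hlift

/-- Injectivity half alone at the genuine place (what the rigidity rows deliver): `Aut(𝒞_v̲) → Aut(𝒟_v̲)` is injective as soon
as every self-equivalence of `𝒞_v̲` over the identity of `𝒟_v̲` is isomorphic to the identity.
([IUTchI] Cor 5.3 (ii) p.144) [claim: Mochizuki2012, status: disputed] -/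
theorem goodLocalFrobenioidOfEmb_descend_injective_of_kernel_trivial
    (hsl : IsSlim (CosetCat (D.PiLoc D.PiXarrow (localToGF F k ι))))
    (hker : letI := GaloisValDatum.normVal k
      ∀ Ψ : (D.goodLocalFrobenioidOfEmb p k ι hX).Cv ≌ (D.goodLocalFrobenioidOfEmb p k ι hX).Cv,
      Nonempty (CatIsomorphism.LiesUnder (D.goodLocalFrobenioidOfEmb p k ι hX).toBase
        (D.goodLocalFrobenioidOfEmb p k ι hX).toBase Ψ
        (CategoryTheory.Equivalence.refl (C := CosetCat (D.PiLoc D.PiXarrow (localToGF F k ι))))) →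
      Nonempty (Ψ.functor ≅ 𝟭 (D.goodLocalFrobenioidOfEmb p k ι hX).Cv)) :
    letI := GaloisValDatum.normVal k
    Function.Injective (CatIsomorphism.descend
      (GoodLocalFrobenioid.hasUnder_toBase_ofGalois _ _ _ _ _ _ _ _ _ _ _ _ _ _ hsl hsl :
        CatIsomorphism.HasUnder (D.goodLocalFrobenioidOfEmb p k ι hX).toBase (D.goodLocalFrobenioidOfEmb p k ι hX).toBase)
      (GoodLocalFrobenioid.underUnique_toBase_ofGalois _ _ _ _ _ _ _ _ _ _ _ _ _ _ hsl hsl)) := by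
  letI := GaloisValDatum.normVal k
  unfold InitialThetaData.goodLocalFrobenioidOfEmb at hker
  exact CatIsomorphism.descend_injective_of_kernel_trivial _ _ hker

end GenuinePlace

end Cor53

end Literature.IUT.HodgeTheaters
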